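import Summits.BirchSwinnertonDyer.Rank1Residual.Additive.QuadraticBranchLowerDescentSemistable
import Summits.BirchSwinnertonDyer.Rank1Residual.Additive.ChiBranchLowerTransportGord
import HarnessLib

/-!
# NON-VACUITY of OUR `E♭`-level Λ-adic conjecture on the quadratic branch: its whole binder telescope
# is INHABITED on every X4(M) pair and on every additive (G)-ordinary defect-2 pair
# (cell `b2b-bsdres`, team n1011, seat p07 (gen 2), row T-N10-low NEXT (d) — the Λ-level twin of
# this seat's `W`-level witnesses `ClassX4M.exists_semistableTwistDatum[_odd]` /
# `exists_semistableTwistDatum_of_typeGOrd_of_semistabilityIndex_eq_two[_odd]`; route planner r2's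
# "vacuity pass" (ROUTE-2 II.4.4) for seat p10's `QuadraticBranchLowerDivisibilityAt`)

HONEST FRAMING (cell `b2b-bsdres`, run/shared/lean/b2b/bsd-rank1-residual/, verbatim in every
file): the goal of the cell is to DELETE the COMBINATION-SHAPED residual classes of the
Birch–Swinnerton-Dyer formula for ALL analytic-rank `≤ 1` elliptic curves over `ℚ` — "full BSD
formula for every rank `≤ 1` curve in class `C`" assembled STRICTLY from published theorems — so
that the rank-`≤ 1` remainder becomes exactly the CONSTRUCTION-SHAPED classes, which are TYPED
(missing-input `Prop`s), NOT attempted. This is not "finishing BSD". Team n1011 (RESIDUAL-MAP §I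
N10 / N11): prove what is provable now; shrink each hard class to its core with data; no claim
beyond stated classes. Research route on the CONSTRUCTION-SHAPED item N10; it stays CONSTRUCTION;
nothing is booked; no label moves. Theorems only (existence statements; no definition, no named
fact; OUR conjecture is neither assumed nor asserted here).

## What this file proves, and why

Seat p10's `QuadraticBranchLowerDivisibilityAt V p` (OUR conjecture; `QuadraticBranchLower.lean`) is a
`∀` over a long telescope of binders — a quadratic number field `K` with `θ² = p*` and
`Gal(ℚ̄/K) ⊴ Γ_ℚ` normal, a `p`-th cyclotomic field `F`, a cyclotomic `ℤ_p`-extension `κ` with a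
topological generator `γ ∈ Gal(ℚ̄/K) ∩ Gal(ℚ̄/F)` matching the cyclotomic variable, the newform `f`
of `V`, the branch series `B` of `V`'s reduction type at `p` (good ordinary / split / non-split
multiplicative, parity of `(p−1)/2`), an eigen-`Λ`-dual datum
`D : ChiEigenSelmerInDualData V K κ (galRange F) γ` of `e_{(p−1)/2} Sel_{p^∞}(E♭/ℚ(μ_{p^∞}))`, and a
period ratio `ϖ` of the right parity — and the class theorems of `X4RankZeroQuadraticBranchLower.lean`
take it as the hypothesis `∀ twist models V of W, QuadraticBranchLowerDivisibilityAt V p`. A `∀` over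
an EMPTY binder set would be true for free and the conditional theorems would say nothing. This file
closes that loophole IN THE KERNEL: on every X4(M) pair (`ClassX4M.exists_quadraticBranchLowerDatum`)
and on every additive (G)-ordinary pair of defect `2`
(`ClassX4Gord.exists_quadraticBranchLowerDatum_of_semistabilityIndex_eq_two`, and the class-free
`exists_quadraticBranchLowerDatum_of_typeGOrd_of_semistabilityIndex_eq_two`), EVERY odd `p`, both
parities at once, there IS a globally minimal twist model `V` with `C • V^{(p*)} = W` (so the outer
`∀ V` is not vacuous) together with a full tuple `(K, F, κ, γ, f, B, D, ϖ)` satisfying every hypothesis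
of the conjecture verbatim (so the inner `∀` is not vacuous either). The tuple is the one seat p10's
descent builds: `K = ℚ(√p*) ⊂ F = ℚ(ζ_p)` (`exists_intermediateField_sq_eq_pStar`), the tree's
cyclotomic datum (`exists_isCyclotomic_isTopGenerator_isCyclotomicVariable_holds`) normalised into
`Gal(ℚ̄/K) ∩ Gal(ℚ̄/F)` and the eigen-descent of a `Λ`-dual datum of `Sel_{p^∞}(W/ℚ_∞)`
(additive-p2's `SelmerDualData.exists_chiEigenInCyclotomic`, Greenberg LNM 1716 §5), the newform and
period ratio of a modular parametrisation datum (`hmodD`, Edixhoven), and the branch series of the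
reduction type (additive-p1's `exists_halfBranchMult_even/odd` on the (M) rows). Core, twist-datum
level: `exists_quadraticBranchLowerDatum_of_twist`. Nothing about the TRUTH of the conjecture is
claimed; labels UNCHANGED; nothing booked.

References: Greenberg 1999 [GreenbergLNM1716] §5; Edixhoven 1991 [EdixhovenManin1991] §1;
Mazur–Tate–Teitelbaum 1986 [MazurTateTeitelbaum1986Invent] §I.10, §I.13–I.14; Silverman *ATAEC*
[SilvermanATAEC1994] V.5.3; Washington [Washington1997] §13.1.
-/

noncomputable section

open scoped Classical MatrixGroups ModularForm NumberField

open CongruenceSubgroup WeierstrassCurve NumberField Literature.NumberTheory.EllipticCurves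
  Literature.NumberTheory.EllipticCurves.ModularForms
  Literature.NumberTheory.EllipticCurves.Rank1Residual
  Literature.NumberTheory.EllipticCurves.Rank1Residual.Typed
  Literature.NumberTheory.GaloisRepresentations
  IsDedekindDomain Rat.HeightOneSpectrum

namespace Summit.BirchSwinnertonDyer.Rank1Residual.Additive

open AdditivePotMult

variable {W : WeierstrassCurve ℚ} [W.IsElliptic] [W.IsGloballyMinimal] {p : ℕ} [hp : Fact p.Prime]

/-! ### §1 Core: a semistable twist datum carries a full binder tuple of the conjecture -/

omit [W.IsElliptic] [W.IsGloballyMinimal] in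
/-- **Core (twist-datum level), every odd `p`, both parities**: for a globally minimal `V`, good
ordinary OR multiplicative at `p`, with `C • V^{(p*)} = W`, the binder telescope of
`QuadraticBranchLowerDivisibilityAt V p` is INHABITED — there are `K = ℚ(√p*)` (degree `2`, normal
`galRange`, `θ² = p*`), `F = ℚ(ζ_p)` (`IsCyclotomicExtension {p} ℚ F`, normal `galRange`), a
cyclotomic `κ` with a topological generator `γ ∈ galRange K ⊓ galRange F` matching the cyclotomic
variable, the newform `f` of `V`, a branch series `B` in the conjecture's reduction-type disjunction,
an eigen-`Λ`-dual datum `D : ChiEigenSelmerInDualData V K κ (galRange F) γ`, and a period ratio `ϖ`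
of the parity of `(p−1)/2`. Construction = seat p10's descent data (additive-p2's
`SelmerDualData.exists_chiEigenInCyclotomic` on a dual datum of `Sel_{p^∞}(W/ℚ_∞)`, parametrisation
datum `hmodD`, additive-p1's `exists_halfBranchMult_even/odd`). [cite: GreenbergLNM1716, §5 (PDF p. 143)]
[cite: EdixhovenManin1991, §1] [cite: MazurTateTeitelbaum1986Invent, §I.10, §I.13–I.14] -/
theorem exists_quadraticBranchLowerDatum_of_twist (hmodD : nonempty_modularParametrizationData)
    (hp2 : p ≠ 2) {V : WeierstrassCurve ℚ} [V.IsElliptic] [V.IsGloballyMinimal] {C : VariableChange ℚ}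
    (hC : C • V.quadraticTwist ((-1 : ℚ) ^ (p / 2) * p) = W) (hred : GoodOrd V p ∨ Mult V p) :
    ∃ (K : Type) (_ : Field K) (_ : NumberField K) (_ : (galRange (K := ℚ) K).Normal)
      (F : Type) (_ : Field F) (_ : NumberField F) (_ : IsCyclotomicExtension {p} ℚ F)
      (_ : (galRange (K := ℚ) F).Normal)
      (κ : ZpExtension ℚ p) (γ : Field.absoluteGaloisGroup ℚ) (N : ℕ) (_ : NeZero N)
      (f : CuspForm (Gamma0 N) 2) (B : PowerSeries ℚ_[p])
      (_ : ChiEigenSelmerInDualData V K κ (galRange (K := ℚ) F) γ) (ϖ : ℚ),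
      Module.finrank ℚ K = 2 ∧ (∃ θ : K, θ ^ 2 = algebraMap ℚ K ((-1) ^ (p / 2) * p)) ∧
      ((IsOrdinaryAt V p ∧
          B = if Even (p / 2) then padicLFunctionBranch f ((unitRoot V p : ℤ_[p]) : ℚ_[p]) (p / 2)
            else padicLFunctionMinusBranch f ((unitRoot V p : ℤ_[p]) : ℚ_[p]) (p / 2)) ∨
        (V.HasSplitMultiplicativeReductionAtPrime p ∧
          B = if Even (p / 2) then padicLFunctionPlusBranchMult f (1 : ℚ_[p]) (p / 2)
            else padicLFunctionMinusBranchMult f (1 : ℚ_[p]) (p / 2)) ∨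
        (V.HasMultiplicativeReductionAtPrime p ∧ ¬ V.HasSplitMultiplicativeReductionAtPrime p ∧
          B = if Even (p / 2) then padicLFunctionPlusBranchMult f (-1 : ℚ_[p]) (p / 2)
            else padicLFunctionMinusBranchMult f (-1 : ℚ_[p]) (p / 2))) ∧
      κ.IsCyclotomic ∧ κ.IsTopGenerator γ ∧ IsCyclotomicVariable p γ ∧
      γ ∈ galRange (K := ℚ) K ∧ γ ∈ galRange (K := ℚ) F ∧ IsNewformOf V f ∧
      (if Even (p / 2) then (ϖ : ℝ) * V.realPeriodRat = plusPeriod f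
        else (ϖ : ℝ) * V.imaginaryPeriodRat = minusPeriod f) := by
  have hpS : ((-1 : ℚ) ^ (p / 2) * p) ≠ 0 :=
    mul_ne_zero (pow_ne_zero _ (by norm_num)) (Nat.cast_ne_zero.mpr hp.out.ne_zero)
  haveI hcycL : IsCyclotomicExtension {p} ℚ (CyclotomicField p ℚ) := by
    have h : (CyclotomicField.algebra p ℚ : Algebra ℚ (CyclotomicField p ℚ)) =
        DivisionRing.toRatAlgebra := Subsingleton.elim _ _
    exact h ▸ CyclotomicField.isCyclotomicExtension p ℚ
  obtain ⟨K, θ, hK2, hθ, hθ2⟩ := exists_intermediateField_sq_eq_pStar p (CyclotomicField p ℚ) hp2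
  haveI : NumberField K := NumberField.of_module_finite ℚ K
  haveI : IsGalois ℚ K := isGalois_of_finrank_eq_two K hK2
  haveI := normal_galRange K hK2 (sigmaQ_ne_one K hK2 hθ hθ2)
  haveI := normal_galRange_cyclotomic p (CyclotomicField p ℚ)
  haveI : (V.quadraticTwist ((-1 : ℚ) ^ (p / 2) * p)).IsElliptic := V.isElliptic_quadraticTwist hpS
  -- the cyclotomic datum of the tree and a `Λ`-dual datum of `Sel_{p^∞}(W/ℚ_∞)`
  obtain ⟨κ, hκ, γ, hγ, hγ'⟩ := exists_isCyclotomic_isTopGenerator_isCyclotomicVariable_holds p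
  obtain ⟨D⟩ := W.nonempty_selmerDualData_holds κ γ hγ
  -- the eigen-descent: normalised generator and eigen-dual datum (same module)
  obtain ⟨γ₁, hγ₁KF, hκγ₁, ⟨g₀, hg₀, hγ₁eq⟩, D', -, -⟩ :=
    SelmerDualData.exists_chiEigenInCyclotomic p (CyclotomicField p ℚ) V K hK2 hθ hθ2 κ hC hp2 D
  -- newform and period ratio of the parity of `(p−1)/2`
  haveI : NeZero (V.conductorNorm ℤ) := ⟨(V.conductorNorm_pos_holds).ne'⟩
  obtain ⟨Dm⟩ := hmodD V
  have hϖ : ∃ ϖ : ℚ, if Even (p / 2) then (ϖ : ℝ) * V.realPeriodRat = plusPeriod Dm.f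
      else (ϖ : ℝ) * V.imaginaryPeriodRat = minusPeriod Dm.f := by
    by_cases he : Even (p / 2)
    · obtain ⟨ϖ, -, hϖ, -⟩ := Dm.exists_rat_mul_realPeriodRat_eq_plusPeriod
      exact ⟨ϖ, by rw [if_pos he]; exact hϖ⟩
    · obtain ⟨ϖ, -, hϖ⟩ := exists_rat_mul_imaginaryPeriodRat_eq_minusPeriod Dm
      exact ⟨ϖ, by rw [if_neg he]; exact hϖ⟩
  obtain ⟨ϖ, hϖ⟩ := hϖ
  -- the branch series of the reduction type
  have hB : ∃ B : PowerSeries ℚ_[p],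
      (IsOrdinaryAt V p ∧
          B = if Even (p / 2) then padicLFunctionBranch Dm.f ((unitRoot V p : ℤ_[p]) : ℚ_[p]) (p / 2)
            else padicLFunctionMinusBranch Dm.f ((unitRoot V p : ℤ_[p]) : ℚ_[p]) (p / 2)) ∨
        (V.HasSplitMultiplicativeReductionAtPrime p ∧
          B = if Even (p / 2) then padicLFunctionPlusBranchMult Dm.f (1 : ℚ_[p]) (p / 2)
            else padicLFunctionMinusBranchMult Dm.f (1 : ℚ_[p]) (p / 2)) ∨
        (V.HasMultiplicativeReductionAtPrime p ∧ ¬ V.HasSplitMultiplicativeReductionAtPrime p ∧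
          B = if Even (p / 2) then padicLFunctionPlusBranchMult Dm.f (-1 : ℚ_[p]) (p / 2)
            else padicLFunctionMinusBranchMult Dm.f (-1 : ℚ_[p]) (p / 2)) := by
    rcases hred with hord | hmult
    · exact ⟨_, Or.inl ⟨hord, rfl⟩⟩
    · by_cases he : Even (p / 2)
      · obtain ⟨B, -, hB, -⟩ := exists_halfBranchMult_even p hp2 he hmult Dm.isNewformOf
        exact ⟨B, hB⟩
      · obtain ⟨B, -, hB, -⟩ := exists_halfBranchMult_odd p hp2 he hmult Dm.isNewformOf
        exact ⟨B, hB⟩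
  obtain ⟨B, hB⟩ := hB
  exact ⟨K, inferInstance, inferInstance, inferInstance, CyclotomicField p ℚ, inferInstance,
    inferInstance, hcycL, inferInstance, κ, γ₁, _, inferInstance, Dm.f, B, D', ϖ, hK2, ⟨θ, hθ2⟩, hB,
    hκ, isTopGenerator_of_kappa_eq κ hκγ₁ hγ, isCyclotomicVariable_of_eq_mul p κ hκ hg₀ hγ₁eq hγ',
    (Subgroup.mem_inf.mp hγ₁KF).1, (Subgroup.mem_inf.mp hγ₁KF).2, Dm.isNewformOf, hϖ⟩

/-! ### §2 Class level: X4(M) and the additive (G)-ordinary defect-2 rows -/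

omit [W.IsGloballyMinimal] in
/-- **NON-VACUITY on X4(M), every odd `p`, both parities**: on every X4(M) pair there is a globally
minimal twist model `V`, MULTIPLICATIVE at `p`, with `C • V^{(p*)} = W` (additive-p1's
`ClassX4M.exists_mult_pStar_twist_model`) carrying a full binder tuple of
`QuadraticBranchLowerDivisibilityAt V p` (§1). So neither the outer `∀ V` of the class theorems
`ClassX4M.…_of_quadraticBranchLower` nor the inner `∀` of the conjecture is vacuous on these rows.
[cite: GreenbergLNM1716, §5 (PDF p. 143)] [cite: EdixhovenManin1991, §1] [cite: SilvermanATAEC1994, V.5.3] -/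
theorem ClassX4M.exists_quadraticBranchLowerDatum (hmodD : nonempty_modularParametrizationData)
    (hX : ClassX4M W p) :
    ∃ (V : WeierstrassCurve ℚ) (_ : V.IsElliptic) (_ : V.IsGloballyMinimal)
      (K : Type) (_ : Field K) (_ : NumberField K) (_ : (galRange (K := ℚ) K).Normal)
      (F : Type) (_ : Field F) (_ : NumberField F) (_ : IsCyclotomicExtension {p} ℚ F)
      (_ : (galRange (K := ℚ) F).Normal)
      (κ : ZpExtension ℚ p) (γ : Field.absoluteGaloisGroup ℚ) (N : ℕ) (_ : NeZero N)
      (f : CuspForm (Gamma0 N) 2) (B : PowerSeries ℚ_[p])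
      (_ : ChiEigenSelmerInDualData V K κ (galRange (K := ℚ) F) γ) (ϖ : ℚ),
      (∃ C : VariableChange ℚ, C • V.quadraticTwist ((-1) ^ (p / 2) * p : ℚ) = W) ∧ Mult V p ∧
      p ≠ 2 ∧ Module.finrank ℚ K = 2 ∧ (∃ θ : K, θ ^ 2 = algebraMap ℚ K ((-1) ^ (p / 2) * p)) ∧
      ((IsOrdinaryAt V p ∧
          B = if Even (p / 2) then padicLFunctionBranch f ((unitRoot V p : ℤ_[p]) : ℚ_[p]) (p / 2)
            else padicLFunctionMinusBranch f ((unitRoot V p : ℤ_[p]) : ℚ_[p]) (p / 2)) ∨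
        (V.HasSplitMultiplicativeReductionAtPrime p ∧
          B = if Even (p / 2) then padicLFunctionPlusBranchMult f (1 : ℚ_[p]) (p / 2)
            else padicLFunctionMinusBranchMult f (1 : ℚ_[p]) (p / 2)) ∨
        (V.HasMultiplicativeReductionAtPrime p ∧ ¬ V.HasSplitMultiplicativeReductionAtPrime p ∧
          B = if Even (p / 2) then padicLFunctionPlusBranchMult f (-1 : ℚ_[p]) (p / 2)
            else padicLFunctionMinusBranchMult f (-1 : ℚ_[p]) (p / 2))) ∧
      κ.IsCyclotomic ∧ κ.IsTopGenerator γ ∧ IsCyclotomicVariable p γ ∧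
      γ ∈ galRange (K := ℚ) K ∧ γ ∈ galRange (K := ℚ) F ∧ IsNewformOf V f ∧
      (if Even (p / 2) then (ϖ : ℝ) * V.realPeriodRat = plusPeriod f
        else (ϖ : ℝ) * V.imaginaryPeriodRat = minusPeriod f) := by
  have hp2 : p ≠ 2 := hX.classX4.1
  obtain ⟨V, iV, iVm, C, hV, hC⟩ := hX.exists_mult_pStar_twist_model
  obtain ⟨K, iK, iKn, iKg, F, iF, iFn, iFc, iFg, κ, γ, N, iN, f, B, D, ϖ, hK2, hθ, hB, hκ, hγ, hcv,
    hγK, hγF, hf, hϖ⟩ := exists_quadraticBranchLowerDatum_of_twist hmodD hp2 hC (Or.inr hV)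
  exact ⟨V, iV, iVm, K, iK, iKn, iKg, F, iF, iFn, iFc, iFg, κ, γ, N, iN, f, B, D, ϖ, ⟨C, hC⟩, hV, hp2,
    hK2, hθ, hB, hκ, hγ, hcv, hγK, hγF, hf, hϖ⟩

variable (W p) in
omit [W.IsGloballyMinimal] in
/-- **NON-VACUITY on the additive (G)-ordinary defect-2 rows, every odd `p`, both parities** (class-free:
`Addv W p ∧ TypeGOrd W p ∧ semistabilityIndex W p = 2`): a globally minimal GOOD ORDINARY twist model
`V` with `C • V^{(p*)} = W` (additive-p2's `TypeGOrd.exists_goodOrd_model_twist_pStar`) carrying a full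
binder tuple of `QuadraticBranchLowerDivisibilityAt V p` (§1; the good-ordinary disjunct with the
unit-root branch of the parity of `(p−1)/2`). [cite: GreenbergLNM1716, §5 (PDF p. 143)] [cite: EdixhovenManin1991, §1] -/
theorem exists_quadraticBranchLowerDatum_of_typeGOrd_of_semistabilityIndex_eq_two [W.IsGloballyMinimal]
    (hmodD : nonempty_modularParametrizationData) (hp2 : p ≠ 2) (hadd : Addv W p) (hG : TypeGOrd W p)
    (he : semistabilityIndex W p = 2) :
    ∃ (V : WeierstrassCurve ℚ) (_ : V.IsElliptic) (_ : V.IsGloballyMinimal)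
      (K : Type) (_ : Field K) (_ : NumberField K) (_ : (galRange (K := ℚ) K).Normal)
      (F : Type) (_ : Field F) (_ : NumberField F) (_ : IsCyclotomicExtension {p} ℚ F)
      (_ : (galRange (K := ℚ) F).Normal)
      (κ : ZpExtension ℚ p) (γ : Field.absoluteGaloisGroup ℚ) (N : ℕ) (_ : NeZero N)
      (f : CuspForm (Gamma0 N) 2) (B : PowerSeries ℚ_[p])
      (_ : ChiEigenSelmerInDualData V K κ (galRange (K := ℚ) F) γ) (ϖ : ℚ),
      (∃ C : VariableChange ℚ, C • V.quadraticTwist ((-1) ^ (p / 2) * p : ℚ) = W) ∧ GoodOrd V p ∧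
      Module.finrank ℚ K = 2 ∧ (∃ θ : K, θ ^ 2 = algebraMap ℚ K ((-1) ^ (p / 2) * p)) ∧
      ((IsOrdinaryAt V p ∧
          B = if Even (p / 2) then padicLFunctionBranch f ((unitRoot V p : ℤ_[p]) : ℚ_[p]) (p / 2)
            else padicLFunctionMinusBranch f ((unitRoot V p : ℤ_[p]) : ℚ_[p]) (p / 2)) ∨
        (V.HasSplitMultiplicativeReductionAtPrime p ∧
          B = if Even (p / 2) then padicLFunctionPlusBranchMult f (1 : ℚ_[p]) (p / 2)
            else padicLFunctionMinusBranchMult f (1 : ℚ_[p]) (p / 2)) ∨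
        (V.HasMultiplicativeReductionAtPrime p ∧ ¬ V.HasSplitMultiplicativeReductionAtPrime p ∧
          B = if Even (p / 2) then padicLFunctionPlusBranchMult f (-1 : ℚ_[p]) (p / 2)
            else padicLFunctionMinusBranchMult f (-1 : ℚ_[p]) (p / 2))) ∧
      κ.IsCyclotomic ∧ κ.IsTopGenerator γ ∧ IsCyclotomicVariable p γ ∧
      γ ∈ galRange (K := ℚ) K ∧ γ ∈ galRange (K := ℚ) F ∧ IsNewformOf V f ∧
      (if Even (p / 2) then (ϖ : ℝ) * V.realPeriodRat = plusPeriod f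
        else (ϖ : ℝ) * V.imaginaryPeriodRat = minusPeriod f) := by
  have hpS : ((-1 : ℚ) ^ (p / 2) * p) ≠ 0 :=
    mul_ne_zero (pow_ne_zero _ (by norm_num)) (Nat.cast_ne_zero.mpr hp.out.ne_zero)
  obtain ⟨V, iV, iVm, hWV, hord⟩ := TypeGOrd.exists_goodOrd_model_twist_pStar W p hp2 hG hadd he
  obtain ⟨C, hC⟩ := exists_variableChange_quadraticTwist_symm V W hpS hWV
  obtain ⟨K, iK, iKn, iKg, F, iF, iFn, iFc, iFg, κ, γ, N, iN, f, B, D, ϖ, hK2, hθ, hB, hκ, hγ, hcv,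
    hγK, hγF, hf, hϖ⟩ := exists_quadraticBranchLowerDatum_of_twist hmodD hp2 hC (Or.inl hord)
  exact ⟨V, iV, iVm, K, iK, iKn, iKg, F, iF, iFn, iFc, iFg, κ, γ, N, iN, f, B, D, ϖ, ⟨C, hC⟩, hord,
    hK2, hθ, hB, hκ, hγ, hcv, hγK, hγF, hf, hϖ⟩

/-- **NON-VACUITY on X4♯(G-ord) ∩ `I₀*` (`e = 2`), every odd `p`** (class form of the previous
theorem; `p ≠ 2` is part of `ClassX4`). [cite: GreenbergLNM1716, §5 (PDF p. 143)] [cite: EdixhovenManin1991, §1] -/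
theorem ClassX4Gord.exists_quadraticBranchLowerDatum_of_semistabilityIndex_eq_two
    (hmodD : nonempty_modularParametrizationData) (hX : ClassX4Gord W p)
    (he : semistabilityIndex W p = 2) :
    ∃ (V : WeierstrassCurve ℚ) (_ : V.IsElliptic) (_ : V.IsGloballyMinimal)
      (K : Type) (_ : Field K) (_ : NumberField K) (_ : (galRange (K := ℚ) K).Normal)
      (F : Type) (_ : Field F) (_ : NumberField F) (_ : IsCyclotomicExtension {p} ℚ F)
      (_ : (galRange (K := ℚ) F).Normal)
      (κ : ZpExtension ℚ p) (γ : Field.absoluteGaloisGroup ℚ) (N : ℕ) (_ : NeZero N)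
      (f : CuspForm (Gamma0 N) 2) (B : PowerSeries ℚ_[p])
      (_ : ChiEigenSelmerInDualData V K κ (galRange (K := ℚ) F) γ) (ϖ : ℚ),
      (∃ C : VariableChange ℚ, C • V.quadraticTwist ((-1) ^ (p / 2) * p : ℚ) = W) ∧ GoodOrd V p ∧
      Module.finrank ℚ K = 2 ∧ (∃ θ : K, θ ^ 2 = algebraMap ℚ K ((-1) ^ (p / 2) * p)) ∧
      ((IsOrdinaryAt V p ∧
          B = if Even (p / 2) then padicLFunctionBranch f ((unitRoot V p : ℤ_[p]) : ℚ_[p]) (p / 2)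
            else padicLFunctionMinusBranch f ((unitRoot V p : ℤ_[p]) : ℚ_[p]) (p / 2)) ∨
        (V.HasSplitMultiplicativeReductionAtPrime p ∧
          B = if Even (p / 2) then padicLFunctionPlusBranchMult f (1 : ℚ_[p]) (p / 2)
            else padicLFunctionMinusBranchMult f (1 : ℚ_[p]) (p / 2)) ∨
        (V.HasMultiplicativeReductionAtPrime p ∧ ¬ V.HasSplitMultiplicativeReductionAtPrime p ∧
          B = if Even (p / 2) then padicLFunctionPlusBranchMult f (-1 : ℚ_[p]) (p / 2)
            else padicLFunctionMinusBranchMult f (-1 : ℚ_[p]) (p / 2))) ∧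
      κ.IsCyclotomic ∧ κ.IsTopGenerator γ ∧ IsCyclotomicVariable p γ ∧
      γ ∈ galRange (K := ℚ) K ∧ γ ∈ galRange (K := ℚ) F ∧ IsNewformOf V f ∧
      (if Even (p / 2) then (ϖ : ℝ) * V.realPeriodRat = plusPeriod f
        else (ϖ : ℝ) * V.imaginaryPeriodRat = minusPeriod f) :=
  exists_quadraticBranchLowerDatum_of_typeGOrd_of_semistabilityIndex_eq_two W p hmodD hX.addv.1
    hX.addv.2 hX.typeGOrd he

end Summit.BirchSwinnertonDyer.Rank1Residual.Additive

end
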